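import Summits.BirchSwinnertonDyer.BirchSwinnertonDyer.Theses.PrintX6
import Summits.BirchSwinnertonDyer.BirchSwinnertonDyer.Theorems.PrintX6KobayashiUpperHalf
import Summits.BirchSwinnertonDyer.Rank1Residual.Supersingular.X6ErrCell145146q1KimTamDefectLocalTorsionTrivial
import HarnessLib

/-!
# Route `PrintX6`, erratum sub-leaf `EisensteinHalfFiveLeErr` (stmt-BirchSwinnertonDyer-21115): the Tam-defect Err cell `(145146q1, p = 5)`
# CLOSED ON THE ROUTE'S TRUST BASE — `BSD(E,5)` from `PublishedInputsX6` (upper half = the PROVED item `UpperHalfX6`) + the flag-free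
# Kurihara-number lower half `X6RankZero.missingLowerBoundAt_cell_145146q1_at5_LT` (ty2-g5; proof-covered Kim twin), NO Perrin-Riou
# Prop. 4.8, NO pack `PublishedAcInputsX6Err` (cell `bsd-print-x6`, seat p2 gen 7 for the vehicle, PLAN v4.6 TURNKEY P4-A6OPEN (T2) cell C4,
# C4 FALLBACK 20:06Z; `--supports` stmt-21115 as helper; closes no item)

PARTITION currency (D-0054): ONE cell of the erratum sub-leaf, per pair — the class `145146q` is `residue:X6~` with an EMPTY register on
desk A's book R895 (PLAN v4.6 C4), so this key is offered for +1 class; nothing booked here; BEYOND-PRINT THEOREM: **NO**.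
The road of record `Supersingular.bsdp_x6r0tam_145146q1_5` (x10b, `X6KimTamDefectRecords`) reads its upper half from Perrin-Riou 2003
Prop. 4.8 (flag `PR03-Prop4.8-Kato-attribution`) and its lower half from the flagged Kim 2026 fact; here the upper half is the route's
`UpperHalfX6` chain (`X6.missingUpperBoundAt_rankZero_of_thm41`: Kobayashi 2003 Thm 4.1/1.2 + B. D. Kim 2013 Cor 3.15 + period units +
Pollack + modularity + GZK = conjuncts of `PublishedInputsX6`; `p = 5` is inside its scope `p ≠ 2`, both period conjuncts are consumed
`p`-uniformly) and the lower half is `Supersingular.X6RankZero.missingLowerBoundAt_cell_145146q1_at5_LT` (depth-2 Kurihara number at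
`151·2551 = 385201 ∈ 𝒩₂` through `Kim2026.…_of_localTorsionTrivial`, unflagged, at the generic layers' edge `5 ≤ 5`). Binders:
`PublishedInputsX6`, the Kim twin, the model, and the displayed data of the road of record (`r_an = 0`, `2 ≤ ord₅ ∏c + 1` (`∏c = 10`), Manin
datum `D` with `5 ∤ c_D`, period transfer, `ψ` surjective at `151` and `2551`, `hδ` = `δ̃⁽²⁾_{385201} ≢ 0 (mod 25)`, valued `10 (mod 25)` —
TWO implementations on TWO seats: ENGINE K kit j138076 (iw-2 seat) + implementation 3d kit j149061 (x10b); PLAN v4.6 matrix row C4).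
`ClassX6 W 5` is derived from the integer model (`#Ẽ(𝔽₅) = 6`, i.e. `a₅ = 0`, kernel count inlined; no point-count lemma restated).
Level-one enclosure of record (not a binder): T₀ = L/ω₁ = 500 (L/Ω⁺ = 250), planner kit j288041 (PARI) / j288047 (Sage); referee S-9: #Ш_an = 25,
∏c = 10, tors 1. References: [Kobayashi2003] Thm 1.2/4.1; [BDKim2013] Cor 3.15; [Kim2022StructureSelmer] Thm 1.9 (6); [Miller2011LMS] Def 1.1;
[Cremona2006] Table 1 (145146q1).
-/

set_option autoImplicit false
set_option linter.dupNamespace false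

noncomputable section

open scoped Classical MatrixGroups ModularForm

open CongruenceSubgroup WeierstrassCurve Literature.NumberTheory.EllipticCurves
  Literature.NumberTheory.EllipticCurves.Rank1Residual
  Literature.NumberTheory.EllipticCurves.Rank1Residual.Typed
  Literature.NumberTheory.EllipticCurves.Rank1Residual.X11RankOneCertificates
  Literature.NumberTheory.EllipticCurves.ModularForms
  Summit.BirchSwinnertonDyer.BirchSwinnertonDyer.Rank1Residual.IntModel
  Summit.BirchSwinnertonDyer.Rank1Residual.X11b
  Summit.BirchSwinnertonDyer.Rank1Residual.Supersingular
  Summit.BirchSwinnertonDyer.BirchSwinnertonDyer.Theses.PrintX6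

namespace Summit.BirchSwinnertonDyer.BirchSwinnertonDyer.Theorems.PrintX6

/-- **`BSD(E,5)` for `E = 145146q1` on the route's trust base — no Perrin-Riou Prop. 4.8, no flagged fact, no anticyclotomic pack.** Upper
half: `X6.missingUpperBoundAt_rankZero_of_thm41` from the conjuncts of `PublishedInputsX6`; lower half:
`X6RankZero.missingLowerBoundAt_cell_145146q1_at5_LT` (depth-2 Kurihara number at `151·2551` through the proof-covered Kim twin, GZK and
modularity = conjuncts 9 and 8 of the pack); `ClassX6 W 5` from the integer model (`classX6_of_intModel`, kernel point count `#Ẽ(𝔽₅) = 6`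
inlined); then `missingPPartAt_of_lower_of_upper` and `bsdp_of_missingPPartAt`. Displayed binders as the road of record
`bsdp_x6r0tam_145146q1_5` minus `h48`/`hKimL` (`hKim` = the UNFLAGGED twin). Per pair; not a class theorem.
[cite: Kobayashi2003, Thm. 4.1 (p. 8) and Thm. 1.2 (p. 2)] [cite: BDKim2013, Cor. 3.15 (p. 199)]
[cite: Kim2022StructureSelmer, Thm. 1.9 (6) (PDF p. 8)] [cite: Miller2011LMS, §1 and Def. 1.1] [cite: Cremona2006, Table 1 (Cremona label 145146q1)] -/
theorem X6.bsdp_145146q1_at5_of_publishedInputsX6 (hPub : PublishedInputsX6)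
    (hKim : Kim2026.rankZero_le_padicValNat_sha_of_kuriharaNumber_ne_zero_of_localTorsionTrivial)
    {W : WeierstrassCurve ℚ} [W.IsElliptic] [W.IsGloballyMinimal]
    (hWeq : W = ⟨1, 0, 1, -3229945761, -70654953055340⟩) (hr0 : W.analyticRank = 0)
    (hkt : 2 ≤ padicValNat 5 W.tamagawaProduct + 1)
    {N : ℕ} [NeZero N] (D : ModularParametrizationData W N) (hc : ¬ (5 : ℤ) ∣ D.maninConstant)
    (hper : ∃ u : ℚ, ‖(u : ℚ_[5])‖ = 1 ∧ W.realPeriodRat = u * plusPeriod D.f)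
    (ψ : (ℓ : ℕ) → (ZMod ℓ)ˣ →* Multiplicative (ZMod (5 ^ 2)))
    (hψ₁ : Function.Surjective (ψ 151)) (hψ₂ : Function.Surjective (ψ 2551))
    (hδ : kuriharaNumber D.f (5 ^ 2) (151 * 2551) ψ ≠ 0) : BSDp W 5 := by
  haveI : Fact (Nat.Prime 5) := ⟨by norm_num⟩
  obtain ⟨h12, h41, hKim315, hϖ, h3, -, hmod, hmod', hGZK⟩ := hPub
  have hIW : integralModelInt W = ⟨1, 0, 1, -3229945761, -70654953055340⟩ :=
    integralModelInt_eq_of_map_eq _ (by rw [hWeq]; ext <;> simp [WeierstrassCurve.map])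
  have hX : ClassX6 W 5 :=
    classX6_of_intModel 5 (by norm_num) hIW (by decide +kernel)
      (natCard_point_eq_of_countPoints 1 0 1 (-3229945761) (-70654953055340) 5 (by norm_num) (by decide +kernel)
        (n := 6) (countPoints_eq_of_fast (by decide +kernel)))
      (by decide) (by decide +kernel)
  have hlow : MissingLowerBoundAt W 5 :=
    X6RankZero.missingLowerBoundAt_cell_145146q1_at5_LT hKim hGZK hmod' hWeq hr0 hkt D hc hper ψ hψ₁ hψ₂ hδ
  exact bsdp_of_missingPPartAt W 5 hGZK (by omega)
    (missingPPartAt_of_lower_of_upper W 5 hlow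
      (X6.missingUpperBoundAt_rankZero_of_thm41 W 5 h41 h12 hKim315 hϖ h3 hmod hmod' hGZK (by norm_num) hX hr0))

end Summit.BirchSwinnertonDyer.BirchSwinnertonDyer.Theorems.PrintX6

end
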